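import Summits.QuantumFields.YangMills.Theorems.UnitScaleTiltFluctuationComparisonRegPrGlobalSlackKernelLegBirth
import Summits.QuantumFields.YangMills.Theorems.UnitScaleTiltFluctuationComparisonRegPrGlobalSlackKernelLegPerRun
import HarnessLib

/-!
# `UnitScaleTiltFluctuationComparisonRegPrGlobalSlackKernelLegResidualSplit` — THE SEVENTH-ORDER RESIDUAL ROW OF 3⁗χ SPLITS INTO «OLD TERMS ARE JETS» (print's (43), EXACT) AND
# «THE BIRTH FAR PARTS ARE θ⁷-SMALL» (print's (57)), PER RUN (crux `FluctuationComparisonRegPrIntL`, stmt-QuantumFields-20520, skeleton v5kC, STUB 3⁗χ; width seat ym-ust-20520-w1 g0)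

WHY.  In the display-level per-run socket `K1aLegRowsOwnAChi` (p585428) the one row that still mixes structure and size is (R3) `RemainderSmallOwnΦ D (residualRemCore q Φ e B) …`:
«run K's `canonPTCore − e − Re jet26(Φ)(B)` is `≤ C_R·e^{−κ𝓛}·θ(n)⁷·x⁴` on its window».  With the canonical birth chart family (`…KernelLegBirth`, p585084: on the new level
`canonPTCore = Re jet26(Φ_birth)(B_X) − (far_X + far^Λ_X)`, a THEOREM) the residual IS `−(far_X + far^Λ_X)` on the new level, and on the old levels it is
`oldTermCore − e − Re jet26(Φ)(B)` — which print's (43) p.266 says is ZERO: «𝒫_j(Y_j, U_k) = ⟨𝒫_j(Y_j), B_k(c₁), …, B_k(c_n)⟩», the old term IS the birth polynomial re-read at the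
current loop variables.  So (R3) is, per run, the conjunction of three single-run displays, each print-shaped:

* §1 **`NewLevelIsBirth q Φ e B`** — on the new level the chart family IS the canonical birth chart family, the vacuum constant is `0`, the configuration IS `Bcfg` (how any candidate
  `(Φ, e, B)` must extend the canonical objects); **`OldTermsAreJetsOwn q Φ e B`** — (M1) EXACT: for `k + 1 ≤ K`, `1 + j ≤ k`, every old block `y` and every level-`(k+1)` field `W`,
  `oldTermCore q K k (1+j) y W = e K j (block y) + Re jet26(Φ K j (block y))(B K (k+1) j (block y) W)`; **`BirthFarSmallOwn q b₀ p₀ κ C_F`** — for `k + 1 ≤ K`, every retained `X`, every `W`,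
  `|far_X(triv, W) + far^Λ_X(triv, W)| ≤ C_F·e^{−κ·dj X}·θ(K−k−1)⁷` (the 𝔖-half is a THEOREM from G3D-06: ★w3's `abs_stepFar_le_theta7`, p585502; the Λ-half needs G3D-07's far row
  re-displayed with a spare `g` — print-faithful, the far monomials being `O(e^{−R₁r(g)})`; see `…KernelLegBirth`'s located item (b)).
* §2 level bookkeeping (`remFam_level_cast`) and **`remainderSmallOwnΦ_of_split`**: `NewLevelIsBirth ∧ OldTermsAreJetsOwn ∧ BirthFarSmallOwn C_F ⟹ RemainderSmallOwnΦ D (residualRemCore q Φ e B) b₀ p₀ κ C_F`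
  at `D := dataOfCoreV3 q (canonPolymerCore q)` (new level: `canonPTCore_birth_eq`, the residual is minus the far parts, level factor `x = 1`, tree length `dj X`; old levels:
  `canonPTCore_old_eq`, the residual vanishes).
* §3 the χ-instance `remainderSmallOwnΦ_chi_of_split` (at `dataOfV3chi p (canonPolymerCore (toCore∘p))`, profile `(𝔠.b₀, 𝔠.p₀)`).
UPSHOT for the v4 display list (memo `WHAT-3CHI-IS-PER-RUN-w1g0-v2.md` §4): (R3) := (M1)-exact `OldTermsAreJetsOwn` + the birth far row `BirthFarSmallOwn` + the definitional `NewLevelIsBirth`.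
HONEST FRAMING: bookkeeping over hypothesis schemas and the core's displayed identities; nothing of [Balaban1985UV3]/[King1986] is asserted; registry untouched; count-neutral
(`--supports stmt-QuantumFields-20520`).  YM₃ on T³ is a rung, not the Clay problem / 𝕋⁴ / a mass gap.

References: T. Bałaban, CMP 102 (1985) 255–275 [Balaban1985UV3] ((33)–(34) p.264, (43)–(44) pp.266–267, (57) p.270, (59)–(61) pp.270–271); C. King, CMP 102 (1986) 649–677 [King1986]
(Thm 3.4 (3.9) p.656, (3.55) p.662).
-/

set_option autoImplicit false

noncomputable section

open scoped BigOperators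
open Finset
open Literature.MathematicalPhysics.QuantumFieldTheory.Balaban1983to89
open Literature.MathematicalPhysics.QuantumFieldTheory.Balaban1983to89.T3ContinuumYM3Torus
open Literature.MathematicalPhysics.QuantumFieldTheory.Balaban1983to89.T3UnitScaleTilt
open Literature.MathematicalPhysics.QuantumFieldTheory.Balaban1983to89.T3LevelShift
open Literature.MathematicalPhysics.QuantumFieldTheory.Balaban1983to89.T3AlphaInputsAC
open Literature.MathematicalPhysics.QuantumFieldTheory.Balaban1983to89.T3AlphaPolymerSocket
open Literature.MathematicalPhysics.QuantumFieldTheory.Balaban1983to89.T3AlphaInputsACTwoRun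
open Literature.MathematicalPhysics.QuantumFieldTheory.Balaban1983to89.T3AlphaInputsACTwoRunLevel
open Literature.MathematicalPhysics.QuantumFieldTheory.Balaban1983to89.TreeLengthTorus (tsys)
open Literature.MathematicalPhysics.QuantumFieldTheory.Balaban1985CMP102
open Literature.MathematicalPhysics.QuantumFieldTheory.Balaban1985CMP102.Setting
open Summit.QuantumFields.Balaban3D.Carriers
open Summit.QuantumFields.Balaban3D.Proofs.Primitives
open Summit.QuantumFields.Balaban3D.Proofs.GroupModelLieC (lieC)
open Summit.QuantumFields.Balaban3D.Proofs.Representation33 (jet26)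
open Summit.QuantumFields.YangMills.Theorems
open Summit.QuantumFields.YangMills.Theorems.GlobalSlackKernelMatching
open Summit.QuantumFields.YangMills.Theorems.GlobalSlackCanonicalPolymers

namespace Summit.QuantumFields.YangMills.Theorems.GlobalSlackKernelLeg

variable {F : T3Family} {𝔠 : AlphaConsts F.L (suGroupModel 2).N} {γ : ℝ} {hγ : 0 < γ} {hγ1 : γ ≤ (min 𝔠.gamma0 1) ^ 2}

/-! ## §1 The three single-run displays -/

section Rows

variable (q : ∀ K, AlphaInputsT3AC.PkgCoreV3 F 𝔠 γ hγ hγ1 K)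

/-- **ON THE NEW LEVEL THE CANDIDATE EXTENDS THE CANONICAL BIRTH OBJECTS** (hypothesis schema on `(Φ, e, B)`, never asserted): for `k + 1 ≤ K` and every retained step-`k` domain `X`,
`Φ K k (domSet X) = birthChartCore q K k (domSet X)`, `e K k (domSet X) = 0`, `B K (k+1) k (domSet X) W = Bcfg_X(triv, W)`. [cite: Balaban1985UV3, (33) p.264, (60)-(61) p.271] -/
def NewLevelIsBirth (Φ : ChartFam ↥(lieC (suGroupModel 2)) F) (e : VacFam F) (B : CfgFam ↥(lieC (suGroupModel 2)) F) : Prop :=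
  ∀ (K k : ℕ), k + 1 ≤ K → ∀ X ∈ newDomsCore q K k (Hist.triv (F.P K) (k + 1)),
    Φ K k (domSet (F := F) 𝔠.lane.carrier.M₁ K k X) = birthChartCore q K k (domSet (F := F) 𝔠.lane.carrier.M₁ K k X) ∧
    e K k (domSet (F := F) 𝔠.lane.carrier.M₁ K k X) = 0 ∧
    ∀ W : GaugeField (F.P K) (k + 1) (Matrix.specialUnitaryGroup (Fin 2) ℂ),
      B K (k + 1) k (domSet (F := F) 𝔠.lane.carrier.M₁ K k X) W = ((q K).𝔖 k).Bcfg X (Hist.triv (F.P K) (k + 1)) W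

/-- **(M1) EXACT, PER RUN — «OLD TERMS ARE JETS»** (hypothesis schema, never asserted; print's (43): `𝒫_j(Y_j, U_k) = ⟨𝒫_j(Y_j), B_k(c₁),…,B_k(c_n)⟩`): for `k + 1 ≤ K`, `j < k`, every
old block `y` of level `1 + j` and every level-`(k+1)` field `W`, run `K`'s old term IS the vacuum constant plus the jet of the chart of index `j` on the block's point set at the
current configuration. [cite: Balaban1985UV3, (43) p.266, (33)-(34) p.264] -/
def OldTermsAreJetsOwn (Φ : ChartFam ↥(lieC (suGroupModel 2)) F) (e : VacFam F) (B : CfgFam ↥(lieC (suGroupModel 2)) F) : Prop :=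
  ∀ (K k : ℕ), k + 1 ≤ K → ∀ j : ℕ, j < k →
    ∀ y ∈ oldBlocks 𝔠.lane.carrier.M₁ (rcolOf (SK F 𝔠 γ hγ hγ1 K) 𝔠.lane.carrier) (Hist.triv (F.P K) (k + 1)) (1 + j),
      ∀ W : GaugeField (F.P K) (k + 1) (Matrix.specialUnitaryGroup (Fin 2) ℂ),
        oldTermCore q K k (1 + j) y W =
          e K j (blockSet K (1 + j) y) + (jet26 (Φ K j (blockSet K (1 + j) y)) (B K (k + 1) j (blockSet K (1 + j) y) W)).re

/-- **THE BIRTH FAR PARTS ARE SEVENTH-ORDER SMALL, PER RUN** (hypothesis schema, never asserted; the 𝔖-half is ★w3's `abs_stepFar_le_theta7` from G3D-06, the Λ-half needs G3D-07's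
far row with a spare `g`): for `k + 1 ≤ K`, every retained `X` and every `W`, `|far_X(triv,W) + far^Λ_X(triv,W)| ≤ C_F·e^{−κ·dj X}·θ(K−k−1)⁷`. [cite: Balaban1985UV3, (57) p.270, p.264 L15-16] -/
def BirthFarSmallOwn (b₀ p₀ κ C_F : ℝ) : Prop :=
  ∀ (K k : ℕ), k + 1 ≤ K → ∀ X ∈ newDomsCore q K k (Hist.triv (F.P K) (k + 1)),
    ∀ W : GaugeField (F.P K) (k + 1) (Matrix.specialUnitaryGroup (Fin 2) ℂ),
      |((q K).𝔖 k).far X (Hist.triv (F.P K) (k + 1)) W + ((q K).𝔄.Λc k).far X (Hist.triv (F.P K) (k + 1)) W| ≤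
        C_F * Real.exp (-(κ * (tsys 3 (nblkOf (SK F 𝔠 γ hγ hγ1 K) 𝔠.lane.carrier k)).dj X)) * θBal F.L γ b₀ p₀ (K - k - 1) ^ 7

end Rows

/-! ## §2 The residual row from the three displays -/

section Split

/-- A rest family read at a shifted field depends on the lattice level only through the modulus identity. [folklore] -/
theorem remFam_level_cast (R : RemFam F) (K : ℕ) {j₁ j₂ : ℕ} (e : j₁ = j₂) (b : ℕ) (Y : Set (Site (F.P K) 0))
    {m' K' j' : ℕ} (h₁ : (F.PP F.m K).sitesPerDir j₁ = (F.PP m' K').sitesPerDir j') (h₂ : (F.PP F.m K).sitesPerDir j₂ = (F.PP m' K').sitesPerDir j')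
    (V : GaugeField (F.PP m' K') j' (Matrix.specialUnitaryGroup (Fin 2) ℂ)) :
    R K j₁ b Y (fieldShift h₁ V) = R K j₂ b Y (fieldShift h₂ V) := by
  subst e; rfl

variable (q : ∀ K, AlphaInputsT3AC.PkgCoreV3 F 𝔠 γ hγ hγ1 K)

/-- **THE SEVENTH-ORDER RESIDUAL ROW FROM «NEW LEVEL IS BIRTH» ∧ «OLD TERMS ARE JETS» ∧ «BIRTH FAR PARTS ARE SMALL»** (own-indexed, run `K` only; window letters for `θ ≥ 0`):
`RemainderSmallOwnΦ (dataOfCoreV3 q (canonPolymerCore q)) (residualRemCore q Φ e B) b₀ p₀ κ C_F`.  New level (`j = K − n − 1`, `x = 1`): by `canonPTCore_birth_eq` the residual is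
`−(far_X + far^Λ_X)` at the retained domain with point set `Y`, tree length `dj X`; old levels: by `canonPTCore_old_eq` and (M1) the residual vanishes.
[cite: Balaban1985UV3, (43) p.266, (57) p.270, (59) p.270; King1986, Thm 3.4 (3.9) p.656] -/
theorem remainderSmallOwnΦ_of_split {Φ : ChartFam ↥(lieC (suGroupModel 2)) F} {e : VacFam F} {B : CfgFam ↥(lieC (suGroupModel 2)) F} {b₀ p₀ κ C_F : ℝ}
    (hL : 1 ≤ F.L) (hγ' : 0 < γ) (hγ1' : γ ≤ 1) (hb : 0 < b₀) (hCF : 0 ≤ C_F)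
    (hNew : NewLevelIsBirth q Φ e B) (hOld : OldTermsAreJetsOwn q Φ e B) (hFar : BirthFarSmallOwn q b₀ p₀ κ C_F) :
    RemainderSmallOwnΦ (AlphaInputsT3AC.dataOfCoreV3 q (canonPolymerCore q)) (residualRemCore q Φ e B) b₀ p₀ κ C_F := by
  classical
  intro K n hn j hj V hV Y hY
  -- name the lattice level `K − n = (K − n − 1) + 1`
  have hk : K - n = K - n - 1 + 1 := by omega
  have hkK : K - n - 1 + 1 ≤ K := by omega
  have hkm : K - n - 1 ≤ F.m + K := by have := F.hm; omega
  rw [remFam_level_cast (residualRemCore q Φ e B) K hk j Y _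
      (F.sitesPerDir_eq (m := F.m) (K := K) (j := K - n - 1 + 1) (m' := F.m) (K' := n) (j' := 0) (by omega)) V]
  set W := fieldShift (F.sitesPerDir_eq (m := F.m) (K := K) (j := K - n - 1 + 1) (m' := F.m) (K' := n) (j' := 0) (by omega)) V with hW
  change Y ∈ canonLocCore q K (K - n) (Hist.triv (F.P K) (K - n)) (1 + j) at hY
  change |canonPTCore q K (K - n - 1 + 1) (1 + j) Y W - e K j Y - (jet26 (Φ K j Y) (B K (K - n - 1 + 1) j Y W)).re| ≤
    C_F * Real.exp (-κ * canonTreeLenCore q K (1 + j) Y) * θBal F.L γ b₀ p₀ n ^ 7 * (((F.L : ℝ) ^ (K - n - 1 - j))⁻¹) ^ 4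
  rw [hk] at hY
  have hθ : 0 ≤ θBal F.L γ b₀ p₀ n := (T3MinimiserStabilityReduction.θBal_pos hL hγ' hγ1' hb p₀ n).le
  by_cases hjk : j = K - n - 1
  · -- the NEW level: the residual is minus the far parts
    subst hjk
    have e1 : 1 + (K - n - 1) = K - n - 1 + 1 := by omega
    rw [e1]
    rw [e1] at hY
    simp only [canonLocCore, if_pos hkK, ite_true, mem_image] at hY
    obtain ⟨X, hX, rfl⟩ := hY
    obtain ⟨hΦ, he, hB⟩ := hNew K (K - n - 1) hkK X hX
    rw [canonPTCore_birth_eq q K (K - n - 1) hkK X hX W, hΦ, he, hB W, canonTreeLenCore_domSet q K (K - n - 1) hkm X]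
    have hxk : (((F.L : ℝ) ^ (K - n - 1 - (K - n - 1)))⁻¹) ^ 4 = 1 := by simp
    rw [hxk, mul_one]
    have key := hFar K (K - n - 1) hkK X hX W
    have hnn : K - (K - n - 1) - 1 = n := by omega
    rw [hnn] at key
    have hid : ∀ (A S : ℝ), |A - S - 0 - A| = |S| := fun A S => by
      rw [show A - S - 0 - A = -S by ring, abs_neg]
    rw [hid, neg_mul]
    exact key
  · -- an OLD level: the residual vanishes by (M1)
    have hjlt : j < K - n - 1 := by omega
    have hi : 1 + j ∈ Finset.Icc 1 (K - n - 1) := Finset.mem_Icc.mpr ⟨by omega, by omega⟩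
    have hik : ¬ (1 + j = K - n - 1 + 1) := by omega
    simp only [canonLocCore, if_pos hkK, if_neg hik, if_pos hi, mem_image] at hY
    obtain ⟨y, hy, rfl⟩ := hY
    rw [canonPTCore_old_eq q K (K - n - 1) hkK (1 + j) hi y hy W, hOld K (K - n - 1) hkK j hjlt y hy W]
    have hid' : ∀ (E J : ℝ), |E + J - E - J| = 0 := fun E J => by
      rw [show E + J - E - J = 0 by ring, abs_zero]
    rw [hid']
    positivity

end Split

/-! ## §3 At the χ-record's datum -/

section Chi

/-- **THE RESIDUAL ROW OF 3⁗χ'S PER-RUN SOCKETS FROM THE THREE DISPLAYS, AT THE χ-DATUM** (`q := toCore ∘ p`, profile `(𝔠.b₀, 𝔠.p₀)`; the record's window letters).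
[cite: Balaban1985UV3, (43) p.266, (57) p.270] -/
theorem remainderSmallOwnΦ_chi_of_split (p : ∀ K, AlphaInputsT3AC.PkgAtV3Chi F 𝔠 γ hγ hγ1 K) {Φ : ChartFam ↥(lieC (suGroupModel 2)) F} {e : VacFam F}
    {B : CfgFam ↥(lieC (suGroupModel 2)) F} {κ C_F : ℝ} (hCF : 0 ≤ C_F)
    (hNew : NewLevelIsBirth (fun K => (p K).toCore) Φ e B) (hOld : OldTermsAreJetsOwn (fun K => (p K).toCore) Φ e B)
    (hFar : BirthFarSmallOwn (fun K => (p K).toCore) 𝔠.b₀ 𝔠.p₀ κ C_F) :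
    RemainderSmallOwnΦ (AlphaInputsT3AC.dataOfV3chi p (canonPolymerCore fun K => (p K).toCore)) (residualRemCore (fun K => (p K).toCore) Φ e B)
      𝔠.b₀ 𝔠.p₀ κ C_F :=
  remainderSmallOwnΦ_of_split (fun K => (p K).toCore) F.hL.2.le hγ (hγ1.trans (sq_min_one_le _ 𝔠.gamma0_pos)) 𝔠.b₀_pos hCF hNew hOld hFar

end Chi

end Summit.QuantumFields.YangMills.Theorems.GlobalSlackKernelLeg

end
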